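import Literature.Probability.Percolation.IntExits
import Literature.Probability.Percolation.AdjSurgeryCross
import HarnessLib

/-!
# The inner same-colour surgeries assembled: two disjoint inner exits, same frame and cross frame (twins of `AdjSurgerySame`, `AdjSurgeryCross`)

Topic `Literature/Probability/Percolation`; family `crit-perc` / near-critical percolation on `𝕋`.
A brick of the INNER half of the near-critical arm-separation theorem for four arms in the ADJACENT
colour arrangement (P. Nolin, EJP 13 (2008), Thm. 11, `j = 4`, `σ = BBWW` [arXiv 0711.4948:
Thm. 10], §4.2 Def. 6–8, §4.4 Lemma 15, internal extremities). From the clean routes of the inner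
pair steps to two DISJOINT inner exits (`IntExit`) with their data:

* same frame (`IntPairData`): `route_or_corner_rows`, `corner_norm`, `exists_exits_prov`;
* the protection data `IntTipProt m up t k χ`;
* cross frame (`IntCrossData` with rotations): `exit_of_ref₁`, `corner_norm_lt`, `ExitRef.toSwap`
  (+ `_side`, `_F𝔄`, `_m𝔄`), `route_far_mem`, `exists_exits_of_rot_prov`.

Everything here is proved; no named facts are introduced.

## References

* P. Nolin, Near-critical percolation in two dimensions, *Electron. J. Probab.* 13 (2008), §4.2
  Def. 6–8, §4.4 Lemma 15, internal extremities (arXiv 0711.4948: Def. 6–8, Lemma 14) [Nolin2008].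
-/

noncomputable section

open Set

namespace Literature.Probability.Percolation

open LatticeModels HalfAnnulus
open IntPairData (term_isCrossing term_eq tip_isIntJ' term_open term_norm)

/-! ### Same frame -/

namespace IntPairData

variable {m N k₀ K T R₀ : ℕ} {χ : SiteConfig (Site 2)}

/-- **Rows of a structure inside `Λ_m`**: every site of `S ∪ corner box` (route to the fence of the
term `u`, tip `z`, scale `k`) inside `Λ_m` lies in the rows `(z₁, z₁ + 2k + 1]`. [folklore] -/
theorem route_or_corner_rows (D : IntPairData m N k₀ K T R₀ χ) {u : ℕ} {c : Finset (Site 2)} {z : Site 2}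
    (hu : (intDom m).lowestSeq χ u = some (c, z)) {S : Set (Site 2)} (hS : S ⊆ D.Bset ∪ (D.fence hu).F) {v : Site 2}
    (hv : v ∈ S ∪ triStrip (z 0 - 2 * D.kOf hu) (z 1 + D.kOf hu) (D.kOf hu) (D.kOf hu)) (hvn : triNorm v < m) :
    z 1 < v 1 ∧ v 1 ≤ z 1 + (2 * D.kOf hu + 1) := by
  rcases hv with hv | hv
  · have hvF := D.clean_route_interior hu hS hv hvn
    have hb := intFenceSet_box ((D.fence hu).F_subset hvF)
    exact ⟨mem_intFenceSet_beyond ((D.fence hu).F_subset hvF) hvn, hb.2.2.2⟩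
  · rw [mem_triStrip] at hv
    have hk := D.one_le_kOf hu
    constructor <;> omega

/-- Sites of the corner box lie inside `Λ_m` (middle tip, `1 ≤ k`). [folklore] -/
theorem corner_norm (D : IntPairData m N k₀ K T R₀ χ) {u : ℕ} {c : Finset (Site 2)} {z : Site 2}
    (hu : (intDom m).lowestSeq χ u = some (c, z)) {v : Site 2}
    (hv : v ∈ triStrip (z 0 - 2 * D.kOf hu) (z 1 + D.kOf hu) (D.kOf hu) (D.kOf hu)) : triNorm v < m := by
  rw [mem_triStrip] at hv
  obtain ⟨hz0, hz1, hz2⟩ := tip_isIntJ' hu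
  have hmid := D.tip_midOf hu
  have hk := D.one_le_kOf hu
  rw [triNorm_eq_max]; omega

/-- **Two inner exits of one colour behind the same side**, with the provenance of the routes. [cite: Nolin2008, §4.4 Lemma 15, internal extremities (arXiv 0711.4948: Lemma 14), σ = BBWW] -/
theorem exists_exits_prov (D : IntPairData m N k₀ K T R₀ χ) :
    ∃ (u₀ u₁ : ℕ) (c₀ c₁ : Finset (Site 2)) (z₀ z₁ : Site 2)
      (hu₀ : (intDom m).lowestSeq χ u₀ = some (c₀, z₀)) (hu₁ : (intDom m).lowestSeq χ u₁ = some (c₁, z₁)),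
      u₀ ≠ u₁ ∧ ∃ (F₀ F₁ : IntExit m (intAnnRegion m N) k₀ K χ) (S₀ S₁ : Set (Site 2)),
        F₀.b = D.b 0 ∧ F₁.b = D.b 1 ∧ F₀.z = z₀ ∧ F₁.z = z₁ ∧ F₀.k = D.kOf hu₀ ∧ F₁.k = D.kOf hu₁ ∧
        PathIn triGraph S₀ F₀.b F₀.m' ∧ PathIn triGraph S₁ F₁.b F₁.m' ∧
        S₀ ⊆ (intAnnRegion m N ∪ intExitZone m F₀.z F₀.k) ∩ χ ∧ S₁ ⊆ (intAnnRegion m N ∪ intExitZone m F₁.z F₁.k) ∩ χ ∧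
        (∀ v ∈ S₀, triNorm v < m → IntExitTight F₀.z F₀.k v) ∧ (∀ v ∈ S₁, triNorm v < m → IntExitTight F₁.z F₁.k v) ∧
        Disjoint (S₀ ∪ triStrip (F₀.z 0 - 2 * F₀.k) (F₀.z 1 + F₀.k) F₀.k F₀.k) (S₁ ∪ triStrip (F₁.z 0 - 2 * F₁.k) (F₁.z 1 + F₁.k) F₁.k F₁.k) ∧
        S₀ ⊆ D.Bset ∪ (D.fence hu₀).F ∧ S₁ ⊆ D.Bset ∪ (D.fence hu₁).F := by
  obtain ⟨u₀, u₁, c₀, c₁, z₀, z₁, hu₀, hu₁, hne, S₀, S₁, hP₀, hP₁, hS₀, hS₁, hdj⟩ := D.exists_two_clean_routes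
  refine ⟨u₀, u₁, c₀, c₁, z₀, z₁, hu₀, hu₁, hne, (D.exitOfRoute 0 hu₀ hP₀ hS₀).toIntExit, (D.exitOfRoute 1 hu₁ hP₁ hS₁).toIntExit, S₀, S₁,
    rfl, rfl, rfl, rfl, rfl, rfl, hP₀, hP₁, ?_, ?_, D.exitOfRoute_tight 0 hu₀ hP₀ hS₀, D.exitOfRoute_tight 1 hu₁ hP₁ hS₁, ?_, hS₀, hS₁⟩
  · exact (D.clean_route_region hu₀ hS₀).trans (Set.inter_subset_inter_left _ (Set.union_subset_union_right _ intFrameZone_subset_intExitZone))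
  · exact (D.clean_route_region hu₁ hS₁).trans (Set.inter_subset_inter_left _ (Set.union_subset_union_right _ intFrameZone_subset_intExitZone))
  · show Disjoint (S₀ ∪ triStrip (z₀ 0 - 2 * D.kOf hu₀) (z₀ 1 + D.kOf hu₀) (D.kOf hu₀) (D.kOf hu₀))
      (S₁ ∪ triStrip (z₁ 0 - 2 * D.kOf hu₁) (z₁ 1 + D.kOf hu₁) (D.kOf hu₁) (D.kOf hu₁))
    rw [Set.disjoint_left]
    intro v hv₀ hv₁
    have hvn : triNorm v < m := by
      rcases hv₀ with hv₀ | hv₀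
      · rcases hv₁ with hv₁ | hv₁
        · exact absurd hv₁ (Set.disjoint_left.1 hdj hv₀)
        · exact D.corner_norm hu₁ hv₁
      · exact D.corner_norm hu₀ hv₀
    obtain ⟨a₀, b₀⟩ := D.route_or_corner_rows hu₀ hS₀ hv₀ hvn
    obtain ⟨a₁, b₁⟩ := D.route_or_corner_rows hu₁ hS₁ hv₁ hvn
    rcases Nat.lt_or_gt_of_ne hne with hlt | hlt
    · have hgap := D.row_gap_of_lt hlt hu₀ hu₁; omega
    · have hgap := D.row_gap_of_lt hlt hu₁ hu₀; omega

end IntPairData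

/-! ### Protection data -/

/-- **Protection data of an inner exit tip**: the nominal tip row is `t` (fence from below) or
`t - 3k` (fence from above), where `t` is the tip row of an open crossing of the inner domain from
below with the raw protection `IntRawOK`, resp. from above with `IntRawOKUp`, at scale `k`. [cite: Nolin2008, §4.4 Lemma 15, internal extremities (arXiv 0711.4948: Lemma 14)] -/
def IntTipProt (m : ℕ) (up : Bool) (t : ℤ) (k : ℕ) (χ : SiteConfig (Site 2)) : Prop :=
  ∃ (c : Finset (Site 2)) (z : Site 2), z 1 = t ∧ IsIntJ m z ∧ (↑c : Set (Site 2)) ⊆ χ ∧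
    (up = false → (intDom m).IsCrossing c z ∧ IntRawOK m c z k χ) ∧
    (up = true → (intDom m).flip.IsCrossing c z ∧ IntRawOKUp m c z k χ)

/-! ### Cross frame -/

namespace IntCrossData

variable {m N k₀ K T₁ T₁' T₂ T₂' R₀ i₁ i₂ : ℕ} {ω : SiteConfig (Site 2)}
  (X : IntCrossData m N k₀ K T₁ T₁' T₂ T₂' R₀ (rotConfig i₁ ω) (rotConfig i₂ ω))

/-- **The inner exit of a route ending in the structure of `D₁`**, with its data and the cone
witnesses of its pieces inside `Λ_m`. [cite: Nolin2008, §4.2 Def. 6–8, §4.4 Lemma 15, internal extremities (arXiv 0711.4948: Def. 6–8, Lemma 14)] -/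
theorem exit_of_ref₁ (hi₁ : i₁ < 6) (hφ₁ : ∀ u, X.φ₁ u = triRotIsoPow i₁ u) (hφ₂ : ∀ u, X.φ₂ u = triRotIsoPow i₂ u)
    (e : X.ExitRef) (he : e.side = 0) (q : Fin 2) {S : Set (Site 2)} (hP : PathIn triGraph S (X.φ₁ (X.D₁.b q)) e.m𝔄)
    (hS : S ⊆ X.B𝔅 ∪ e.F𝔄) :
    ∃ (F : IntExit m (intAnnRegion m N) k₀ K (rotConfig i₁ ω)) (up : Bool) (t : ℤ),
      F.b = X.D₁.b q ∧ X.φ₁ F.m' = e.m𝔄 ∧ F.z 1 = (if up then t - 3 * (F.k : ℤ) else t) ∧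
      (-(m : ℤ) + 32 * F.k + 1 ≤ t ∧ t ≤ -(32 * (F.k : ℤ) + 1)) ∧ IntTipProt m up t F.k (rotConfig i₁ ω) ∧
      PathIn triGraph (X.φ₁.symm '' S) F.b F.m' ∧
      X.φ₁.symm '' S ⊆ (intAnnRegion m N ∪ intExitZone m F.z F.k) ∩ rotConfig i₁ ω ∧
      (∀ v ∈ X.φ₁.symm '' S, triNorm v < m → IntExitTight F.z F.k v) ∧
      (∀ v ∈ e.F𝔄 ∪ triRotIsoPow i₁ '' triStrip (F.z 0 - 2 * F.k) (F.z 1 + F.k) F.k F.k,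
        ∃ u, triRotIsoPow i₁ u = v ∧ u 1 ≤ -1 ∧ 1 ≤ u 0 + u 1) := by
  cases e with
  | below₂ u c z hu => exact absurd he (by simp [ExitRef.side])
  | up₂ u d z hu => exact absurd he (by simp [ExitRef.side])
  | below₁ u c z hu =>
    have hP' : PathIn triGraph S (X.φ₁ (X.D₁.b q)) (X.φ₁ (X.D₁.fence hu).m') := hP
    have hS' : S ⊆ X.B𝔅 ∪ X.φ₁ '' (X.D₁.fence hu).F := hS
    set F := X.exitBelow₁ hi₁ hφ₁ hφ₂ hu q hP' hS' with hF
    obtain ⟨hjK, hraw⟩ := X.D₁.jOf_spec hu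
    have hmid := X.D₁.tip_midOf hu
    change IntRawOK m c z (X.D₁.kOf hu) _ at hraw
    obtain ⟨hz0, hz1, hz2⟩ := tip_isIntJ' hu
    refine ⟨F, false, z 1, rfl, rfl, by simp [hF], hmid, ⟨c, z, rfl, tip_isIntJ' hu, term_open hu, fun _ => ⟨term_isCrossing hu, hraw⟩,
      fun h => absurd h (by decide)⟩, ?_, ?_, X.exitBelow₁_tight hi₁ hφ₁ hφ₂ hu q hP' hS', ?_⟩
    · have h := pathIn_map_iso X.φ₁.symm hP'
      rw [RelIso.symm_apply_apply, RelIso.symm_apply_apply] at h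
      exact h
    · rintro v ⟨w, hw, rfl⟩
      rcases hS' hw with hw | ⟨y, hy, hyw⟩
      · have hr := X.symm_mem_region₁ hi₁ hφ₁ hφ₂ hw
        exact ⟨Or.inl hr.1, hr.2⟩
      · rw [← hyw, RelIso.symm_apply_apply]
        have hF := (X.D₁.fence hu).F_subset hy
        exact ⟨Or.inr (intFrameZone_subset_intExitZone hF.1.1.1), intFenceSet_subset hF⟩
    · intro v hv
      have hk := X.D₁.one_le_kOf hu
      rcases hv with ⟨y, hy, hyv⟩ | ⟨y, hy, hyv⟩
      · refine ⟨y, by rw [← hyv, hφ₁], ?_⟩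
        have hb := intFenceSet_box ((X.D₁.fence hu).F_subset hy)
        have hmid' : -(m : ℤ) + 32 * (X.D₁.kOf hu : ℤ) + 1 ≤ z 1 ∧ z 1 ≤ -(32 * (X.D₁.kOf hu : ℤ) + 1) := hmid
        have hk' : (1 : ℤ) ≤ (X.D₁.kOf hu : ℤ) := by exact_mod_cast hk
        constructor <;> omega
      · refine ⟨y, hyv, ?_⟩
        rw [mem_triStrip] at hy
        simp only [hF, exitBelow₁_z, exitBelow₁_k] at hy
        have hmid' : -(m : ℤ) + 32 * (X.D₁.kOf hu : ℤ) + 1 ≤ z 1 ∧ z 1 ≤ -(32 * (X.D₁.kOf hu : ℤ) + 1) := hmid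
        have hk' : (1 : ℤ) ≤ (X.D₁.kOf hu : ℤ) := by exact_mod_cast hk
        constructor <;> omega
  | up₁ u d z hu =>
    have hP' : PathIn triGraph S (X.φ₁ (X.D₁.b q)) (X.φ₁ (X.D₁.fenceUp hu).m') := hP
    have hS' : S ⊆ X.B𝔅 ∪ X.φ₁ '' (X.D₁.fenceUp hu).F := hS
    set F := X.exitUp₁ hi₁ hφ₁ hφ₂ hu q hP' hS' with hF
    obtain ⟨hjK, hraw⟩ := X.D₁.jOfUp_spec hu
    have hmid := X.D₁.tipUp_mid hu
    change IntRawOKUp m d z (X.D₁.kOfUp hu) _ at hraw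
    obtain ⟨hz0, hz1, hz2⟩ := IntPairDataB.tipUp_isIntJ hu
    refine ⟨F, true, z 1, rfl, rfl, by simp [hF, zUp_one], hmid,
      ⟨d, z, rfl, IntPairDataB.tipUp_isIntJ hu, IntPairDataB.termUp_open hu, fun h => absurd h (by decide),
        fun _ => ⟨IntPairDataB.termUp_isCrossing' hu, hraw⟩⟩, ?_, ?_, X.exitUp₁_tight hi₁ hφ₁ hφ₂ hu q hP' hS', ?_⟩
    · have h := pathIn_map_iso X.φ₁.symm hP'
      rw [RelIso.symm_apply_apply, RelIso.symm_apply_apply] at h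
      exact h
    · rintro v ⟨w, hw, rfl⟩
      rcases hS' hw with hw | ⟨y, hy, hyw⟩
      · have hr := X.symm_mem_region₁ hi₁ hφ₁ hφ₂ hw
        exact ⟨Or.inl hr.1, hr.2⟩
      · rw [← hyw, RelIso.symm_apply_apply]
        have hF' := (X.D₁.fenceUp hu).F_subset hy
        exact ⟨Or.inr (intFrameZoneBelow_subset_intExitZone (k := X.D₁.kOfUp hu) (z := zUp z (X.D₁.kOfUp hu)) (z' := z)
          (zUp_zero _ _).symm (by rw [zUp_one]; ring) hF'.1.1.1), intFenceSetUp_subset hF'⟩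
    · intro v hv
      have hk := X.D₁.one_le_kOfUp hu
      rcases hv with ⟨y, hy, hyv⟩ | ⟨y, hy, hyv⟩
      · refine ⟨y, by rw [← hyv, hφ₁], ?_⟩
        have hb := intFenceSetUp_box ((X.D₁.fenceUp hu).F_subset hy)
        have hmid' : -(m : ℤ) + 32 * (X.D₁.kOfUp hu : ℤ) + 1 ≤ z 1 ∧ z 1 ≤ -(32 * (X.D₁.kOfUp hu : ℤ) + 1) := hmid
        have hk' : (1 : ℤ) ≤ (X.D₁.kOfUp hu : ℤ) := by exact_mod_cast hk
        constructor <;> omega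
      · refine ⟨y, hyv, ?_⟩
        rw [mem_triStrip] at hy
        simp only [hF, exitUp₁_z, exitUp₁_k, zUp_zero, zUp_one] at hy
        have hmid' : -(m : ℤ) + 32 * (X.D₁.kOfUp hu : ℤ) + 1 ≤ z 1 ∧ z 1 ≤ -(32 * (X.D₁.kOfUp hu : ℤ) + 1) := hmid
        have hk' : (1 : ℤ) ≤ (X.D₁.kOfUp hu : ℤ) := by exact_mod_cast hk
        unfold IntPairDataB.kOfUp at hy hmid' hk'
        constructor <;> omega

/-- Corner boxes of inner exits lie inside `Λ_m`. [folklore] -/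
theorem corner_norm_lt {i : ℕ} {z : Site 2} (hz : IsIntJ m z) {k : ℕ} (hk : 1 ≤ k) (hmid : -(m : ℤ) + 2 * k + 1 ≤ z 1 ∧ z 1 ≤ -(2 * (k : ℤ) + 1))
    {v : Site 2} (hv : v ∈ triRotIsoPow i '' triStrip (z 0 - 2 * k) (z 1 + k) k k) : triNorm v < m := by
  obtain ⟨u, hu, rfl⟩ := hv
  rw [mem_triStrip] at hu
  obtain ⟨hz0, hz1, hz2⟩ := hz
  rw [triNorm_triRotIsoPow, triNorm_eq_max]
  omega

/-- **Swapping an exit reference** to the swapped cross structure. [folklore] -/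
def ExitRef.toSwap : X.ExitRef → X.swap.ExitRef
  | .below₁ u c z hu => .below₂ u c z hu
  | .up₁ u d z hu => .up₂ u d z hu
  | .below₂ u c z hu => .below₁ u c z hu
  | .up₂ u d z hu => .up₁ u d z hu

/-- Swapping flips the side. [folklore] -/
theorem ExitRef.toSwap_side (X : IntCrossData m N k₀ K T₁ T₁' T₂ T₂' R₀ (rotConfig i₁ ω) (rotConfig i₂ ω)) (er : X.ExitRef) : (ExitRef.toSwap X er).side = 1 - er.side := by
  cases er <;> rfl

/-- Swapping keeps the actual connection. [folklore] -/
theorem ExitRef.toSwap_F𝔄 (X : IntCrossData m N k₀ K T₁ T₁' T₂ T₂' R₀ (rotConfig i₁ ω) (rotConfig i₂ ω)) (er : X.ExitRef) : (ExitRef.toSwap X er).F𝔄 = er.F𝔄 := by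
  cases er <;> rfl

/-- Swapping keeps the actual fence site. [folklore] -/
theorem ExitRef.toSwap_m𝔄 (X : IntCrossData m N k₀ K T₁ T₁' T₂ T₂' R₀ (rotConfig i₁ ω) (rotConfig i₂ ω)) (er : X.ExitRef) : (ExitRef.toSwap X er).m𝔄 = er.m𝔄 := by
  cases er <;> rfl

/-- A route site inside `Λ_m` is a fence site. [folklore] -/
theorem route_far_mem (hφ₁ : ∀ u, X.φ₁ u = triRotIsoPow i₁ u) (hφ₂ : ∀ u, X.φ₂ u = triRotIsoPow i₂ u)
    {e : X.ExitRef} {S : Set (Site 2)} (hS : S ⊆ X.B𝔅 ∪ e.F𝔄) {v : Site 2} (hv : v ∈ S) (hvn : triNorm v < m) : v ∈ e.F𝔄 := by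
  rcases hS hv with h | h
  · exact absurd (X.B𝔅_norm_ge hφ₁ hφ₂ h) (not_le.2 hvn)
  · exact h

/-- The mid margin of an inner exit produced by `exit_of_ref₁`, at the scale of the exit. [folklore] -/
theorem exit_mid_of_prot {F : IntExit m (intAnnRegion m N) k₀ K (rotConfig i₁ ω)} {up : Bool} {t : ℤ}
    (hFz : F.z 1 = (if up then t - 3 * (F.k : ℤ) else t)) (hmid : -(m : ℤ) + 32 * F.k + 1 ≤ t ∧ t ≤ -(32 * (F.k : ℤ) + 1))
    (hk : 1 ≤ F.k) (hzJ : IsIntJ m F.z) : -(m : ℤ) + 2 * F.k + 1 ≤ F.z 1 ∧ F.z 1 ≤ -(2 * (F.k : ℤ) + 1) := by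
  obtain ⟨-, hz1, -⟩ := hzJ
  cases up <;> simp at hFz <;> constructor <;> omega

/-- **Two inner exits of one colour behind two different sides**, from a cross structure: one exit in
each frame, routes from the far ends, kinds, tips and protections, regions, tightness, and DISJOINT
actual structures; with the provenance of the routes. [cite: Nolin2008, §4.2 Def. 6–8, §4.4 Lemma 15, internal extremities (arXiv 0711.4948: Def. 6–8, Lemma 14), σ = BBWW] -/
theorem exists_exits_of_rot_prov (hi₁ : i₁ < 6) (hi₂ : i₂ < 6) (hne : i₁ ≠ i₂)
    (hφ₁ : ∀ u, X.φ₁ u = triRotIsoPow i₁ u) (hφ₂ : ∀ u, X.φ₂ u = triRotIsoPow i₂ u) :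
    ∃ (q : Fin 2) (F : IntExit m (intAnnRegion m N) k₀ K (rotConfig i₁ ω)) (F' : IntExit m (intAnnRegion m N) k₀ K (rotConfig i₂ ω))
      (S S' : Set (Site 2)) (up up' : Bool) (t t' : ℤ),
      F.b = X.D₁.b q ∧ F'.b = X.D₂.b q ∧
      F.z 1 = (if up then t - 3 * (F.k : ℤ) else t) ∧ F'.z 1 = (if up' then t' - 3 * (F'.k : ℤ) else t') ∧
      (-(m : ℤ) + 32 * F.k + 1 ≤ t ∧ t ≤ -(32 * (F.k : ℤ) + 1)) ∧ (-(m : ℤ) + 32 * F'.k + 1 ≤ t' ∧ t' ≤ -(32 * (F'.k : ℤ) + 1)) ∧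
      IntTipProt m up t F.k (rotConfig i₁ ω) ∧ IntTipProt m up' t' F'.k (rotConfig i₂ ω) ∧
      PathIn triGraph S F.b F.m' ∧ PathIn triGraph S' F'.b F'.m' ∧
      S ⊆ (intAnnRegion m N ∪ intExitZone m F.z F.k) ∩ rotConfig i₁ ω ∧
      S' ⊆ (intAnnRegion m N ∪ intExitZone m F'.z F'.k) ∩ rotConfig i₂ ω ∧
      (∀ v ∈ S, triNorm v < m → IntExitTight F.z F.k v) ∧ (∀ v ∈ S', triNorm v < m → IntExitTight F'.z F'.k v) ∧
      Disjoint (triRotIsoPow i₁ '' (S ∪ triStrip (F.z 0 - 2 * F.k) (F.z 1 + F.k) F.k F.k))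
        (triRotIsoPow i₂ '' (S' ∪ triStrip (F'.z 0 - 2 * F'.k) (F'.z 1 + F'.k) F'.k F'.k)) ∧
      triRotIsoPow i₁ '' S ⊆ X.B𝔅 ∪ X.FF𝔉 ∧ triRotIsoPow i₂ '' S' ⊆ X.B𝔅 ∪ X.FF𝔉 := by
  obtain ⟨e₀, e₁, S₀, S₁, hside, hP₀, hP₁, -, -, hS₀, hS₁, hdj⟩ := X.exists_two_clean_routes_of_rot hi₁ hi₂ hne hφ₁ hφ₂
  have hprov : ∀ (e : X.ExitRef) (T : Set (Site 2)), T ⊆ X.B𝔅 ∪ e.F𝔄 → T ⊆ X.B𝔅 ∪ X.FF𝔉 := fun e T hT v hv =>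
    (hT hv).imp_right fun h => e.F𝔄_subset_FF h
  have hφ₁' : ∀ u, X.swap.φ₁ u = triRotIsoPow i₂ u := hφ₂
  have hφ₂' : ∀ u, X.swap.φ₂ u = triRotIsoPow i₁ u := hφ₁
  have hsides : ∀ e : X.ExitRef, e.side = 0 ∨ e.side = 1 := fun e => by rcases e with _ | _ | _ | _ <;> simp [ExitRef.side]
  have himg : ∀ T : Set (Site 2), triRotIsoPow i₁ '' (X.φ₁.symm '' T) = T := fun T => by
    ext v; constructor
    · rintro ⟨u, ⟨w, hw, rfl⟩, rfl⟩; rw [← hφ₁, RelIso.apply_symm_apply]; exact hw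
    · intro hv; exact ⟨X.φ₁.symm v, ⟨v, hv, rfl⟩, by rw [← hφ₁, RelIso.apply_symm_apply]⟩
  have himg' : ∀ T : Set (Site 2), triRotIsoPow i₂ '' (X.swap.φ₁.symm '' T) = T := fun T => by
    ext v; constructor
    · rintro ⟨u, ⟨w, hw, rfl⟩, rfl⟩; rw [← hφ₁', RelIso.apply_symm_apply]; exact hw
    · intro hv; exact ⟨X.swap.φ₁.symm v, ⟨v, hv, rfl⟩, by rw [← hφ₁', RelIso.apply_symm_apply]⟩
  have cones : ∀ {A B : Set (Site 2)},
      (∀ v ∈ A, ∃ u, triRotIsoPow i₁ u = v ∧ u 1 ≤ -1 ∧ 1 ≤ u 0 + u 1) →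
      (∀ v ∈ B, ∃ u, triRotIsoPow i₂ u = v ∧ u 1 ≤ -1 ∧ 1 ≤ u 0 + u 1) →
      ∀ v ∈ A, v ∈ B → False := by
    intro A B hA hB v hvA hvB
    obtain ⟨u, huv, hu⟩ := hA v hvA
    obtain ⟨u', hu'v, hu'⟩ := hB v hvB
    have h := disjoint_image_rot_of_ne hi₁ hi₂ hne (B := {u}) (B' := {u'}) (fun x hx => by rw [Set.mem_singleton_iff.1 hx]; exact hu)
      (fun x hx => by rw [Set.mem_singleton_iff.1 hx]; exact hu')
    exact Set.disjoint_left.1 h ⟨u, rfl, huv⟩ ⟨u', rfl, hu'v⟩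
  have hk₁ : ∀ (F : IntExit m (intAnnRegion m N) k₀ K (rotConfig i₁ ω)), 1 ≤ F.k := fun F =>
    one_le_trapScale (by have := X.D₁.hk₀; omega) _
  have hk₂ : ∀ (F : IntExit m (intAnnRegion m N) k₀ K (rotConfig i₂ ω)), 1 ≤ F.k := fun F =>
    one_le_trapScale (by have := X.D₂.hk₀; omega) _
  rcases hsides e₀ with h0 | h0
  · have h1 : e₁.side = 1 := by
      rcases hsides e₁ with h | h
      · exact absurd (h0.trans h.symm) hside
      · exact h
    obtain ⟨F, up, t, hFa, hFm, hFz, hmid, hprot, hPF, hSF, htF, hcF⟩ := X.exit_of_ref₁ hi₁ hφ₁ hφ₂ e₀ h0 0 hP₀ hS₀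
    have h1' : (ExitRef.toSwap X e₁).side = 0 := by rw [ExitRef.toSwap_side, h1]; decide
    have hP₁' : PathIn triGraph S₁ (X.swap.φ₁ (X.swap.D₁.b 0)) (ExitRef.toSwap X e₁).m𝔄 := by
      have e1 : X.swap.φ₁ (X.swap.D₁.b 0) = X.φ₁ (X.D₁.b 1) := X.start1.symm
      rw [e1, ExitRef.toSwap_m𝔄]; exact hP₁
    have hS₁' : S₁ ⊆ X.swap.B𝔅 ∪ (ExitRef.toSwap X e₁).F𝔄 := by rw [swap_B𝔅, ExitRef.toSwap_F𝔄]; exact hS₁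
    obtain ⟨F', up', t', hFa', hFm', hFz', hmid', hprot', hPF', hSF', htF', hcF'⟩ := X.swap.exit_of_ref₁ hi₂ hφ₁' hφ₂' _ h1' 0 hP₁' hS₁'
    rw [ExitRef.toSwap_F𝔄] at hcF'
    have hFmid := exit_mid_of_prot hFz hmid (hk₁ F) F.z_isIntJ
    have hF'mid := exit_mid_of_prot hFz' hmid' (hk₂ F') F'.z_isIntJ
    refine ⟨0, F, F', X.φ₁.symm '' S₀, X.swap.φ₁.symm '' S₁, up, up', t, t', hFa, hFa', hFz, hFz', hmid, hmid', hprot, hprot', hPF, hPF',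
      hSF, hSF', htF, htF', ?_, by rw [himg]; exact hprov e₀ S₀ hS₀, by rw [himg']; exact hprov e₁ S₁ hS₁⟩
    rw [Set.image_union, Set.image_union, himg, himg']
    rw [Set.disjoint_left]
    rintro v (hv | hv) (hv' | hv')
    · exact Set.disjoint_left.1 hdj hv hv'
    · have hvn := corner_norm_lt F'.z_isIntJ (hk₂ F') hF'mid hv'
      exact cones hcF hcF' v (Or.inl (X.route_far_mem hφ₁ hφ₂ hS₀ hv hvn)) (Or.inr hv')
    · have hvn := corner_norm_lt F.z_isIntJ (hk₁ F) hFmid hv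
      have h := X.swap.route_far_mem hφ₁' hφ₂' hS₁' hv' hvn
      rw [ExitRef.toSwap_F𝔄] at h
      exact cones hcF hcF' v (Or.inr hv) (Or.inl h)
    · exact cones hcF hcF' v (Or.inr hv) (Or.inr hv')
  · have h1 : e₁.side = 0 := by
      rcases hsides e₁ with h | h
      · exact h
      · exact absurd (h0.trans h.symm) hside
    obtain ⟨F, up, t, hFa, hFm, hFz, hmid, hprot, hPF, hSF, htF, hcF⟩ := X.exit_of_ref₁ hi₁ hφ₁ hφ₂ e₁ h1 1 hP₁ hS₁
    have h0' : (ExitRef.toSwap X e₀).side = 0 := by rw [ExitRef.toSwap_side, h0]; decide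
    have hP₀' : PathIn triGraph S₀ (X.swap.φ₁ (X.swap.D₁.b 1)) (ExitRef.toSwap X e₀).m𝔄 := by
      have e1 : X.swap.φ₁ (X.swap.D₁.b 1) = X.φ₁ (X.D₁.b 0) := X.start0.symm
      rw [e1, ExitRef.toSwap_m𝔄]; exact hP₀
    have hS₀' : S₀ ⊆ X.swap.B𝔅 ∪ (ExitRef.toSwap X e₀).F𝔄 := by rw [swap_B𝔅, ExitRef.toSwap_F𝔄]; exact hS₀
    obtain ⟨F', up', t', hFa', hFm', hFz', hmid', hprot', hPF', hSF', htF', hcF'⟩ := X.swap.exit_of_ref₁ hi₂ hφ₁' hφ₂' _ h0' 1 hP₀' hS₀'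
    rw [ExitRef.toSwap_F𝔄] at hcF'
    have hFmid := exit_mid_of_prot hFz hmid (hk₁ F) F.z_isIntJ
    have hF'mid := exit_mid_of_prot hFz' hmid' (hk₂ F') F'.z_isIntJ
    refine ⟨1, F, F', X.φ₁.symm '' S₁, X.swap.φ₁.symm '' S₀, up, up', t, t', hFa, hFa', hFz, hFz', hmid, hmid', hprot, hprot', hPF, hPF',
      hSF, hSF', htF, htF', ?_, by rw [himg]; exact hprov e₁ S₁ hS₁, by rw [himg']; exact hprov e₀ S₀ hS₀⟩
    rw [Set.image_union, Set.image_union, himg, himg']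
    rw [Set.disjoint_left]
    rintro v (hv | hv) (hv' | hv')
    · exact Set.disjoint_left.1 hdj hv' hv
    · have hvn := corner_norm_lt F'.z_isIntJ (hk₂ F') hF'mid hv'
      exact cones hcF hcF' v (Or.inl (X.route_far_mem hφ₁ hφ₂ hS₁ hv hvn)) (Or.inr hv')
    · have hvn := corner_norm_lt F.z_isIntJ (hk₁ F) hFmid hv
      refine cones hcF hcF' v (Or.inr hv) (Or.inl ?_)
      have h := X.swap.route_far_mem hφ₁' hφ₂' hS₀' hv' hvn
      rw [ExitRef.toSwap_F𝔄] at h; exact h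
    · exact cones hcF hcF' v (Or.inr hv) (Or.inr hv')

end IntCrossData

end Literature.Probability.Percolation
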